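import Summits.ResolutionOfSingularities.ResolutionOfSingularities.Theorems.FrobeniusClosingPatchingRelPerfectCrossingLinesPersistence
import Summits.ResolutionOfSingularities.ResolutionOfSingularities.Theorems.FrobeniusClosingPatchingRelPerfectTwoQuadricMemberAlgebra
import HarnessLib

/-!
# Crux `PatchingRelPerfect` (stmt-ResolutionOfSingularities-16161), chain W5.2 — the CROSSING-LINES
# member `I = (x₀x₁ + x₂x₃, x₃²) + 𝔪⁴`, part 5: the hypotheses on the charts of `Bl_𝔪`

[OURS · L1 W5.2 · kernel certificate, res-L1-w52-plan-1 NAMING 2026-08-27T17:00:47Z (O2′)]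
On a Rees chart `B_i = R[M/c_i]` of `Bl_M Spec R` (`c` quasi-regular, `R/(c)` a regular domain;
in the application `R = S` regular local with regular system of parameters `c = x`) the towers
of parts 2–4 need regular-sequence and regular-quotient hypotheses on the exceptional parameter
`u = c_i/1`, chart generators `e_j`, and the host `v` (the de-homogenised quadric
`x₀x₁ + x₂x₃`, which is `e₀e₁ + e₃` on the chart of `x₂` and `e_a + e₂e₃` on the charts of
`x₀`, `x₁`).  All of them come from ONE Jacobian certificate: modulo `(u, e_d)` the host is a
VARIABLE `T_r` of the polynomial ring `B_i/(u, e_d) ≅ (R/(c))[T_j : j ≠ i, d]`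
(`TwoQuadric.exists_quotEquiv_killGen`, p544550).  THIS FILE proves:

* `CrossingLines.hyps_of_kill_eq_X` — if the host reduces to a variable after killing `e_d`,
  then `(u, e_d, v)` is weakly regular (hence quasi-regular) and `B_i/(u, e_d, v)` is regular;
* `CrossingLines.forall_mem_span_of_ne_zero`, `mem_nonZeroDivisors_host` — the host is regular
  modulo `u` and a non-zero-divisor of `B_i` (`B_i/(u)` is a polynomial ring over a domain;
  `B_i` is a domain for `c_i ≠ 0`);
* `CrossingLines.isWeaklyRegular_u_host_gen` — `(u, v, e_d)` is weakly regular (EXCHANGE LEMMA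
  of part 1: the order needed by the crossing tower, part 3b);
* the three shapes: `hyps_host_mul_left` / `hyps_host_mul_right` (`v = e_m e_n + e_r`, kill
  `e_m` or `e_n`: chart of `x₂`) and `hyps_host_add` (`v = e_a + e_b e_d`, kill `e_d`: charts of
  `x₀`, `x₁`).

Any commutative ring / any characteristic; fact-free; nothing here is a statement of the
manuscript under review (AI-written; AI review weaker than expert review).

## References

* H. Matsumura, *Commutative Ring Theory*, CUP 1986, Thm. 14.2 (Jacobian criterion shape),
  Thm. 16.2 (i). [Matsumura1987]
* The Stacks Project, Tags 0804, 0BIQ. [StacksProject]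
-/

-- `Summit.<Summit>.<Sub>.Theorems` with `Sub = Summit` (single-conjunct summit, D-0017)
set_option linter.dupNamespace false

noncomputable section

open CategoryTheory CategoryTheory.Limits AlgebraicGeometry Literature.AlgebraicGeometry.Resolution
open scoped Pointwise nonZeroDivisors

namespace Summit.ResolutionOfSingularities.ResolutionOfSingularities.Theorems

universe u

namespace CrossingLines

open CuspMember TwoQuadric

section Kill

variable {R : Type u} [CommRing R] {n : ℕ} (c : Fin n → R) (i : Fin n) (d : {j : Fin n // j ≠ i})

/-- The exceptional ideal `(u)`, `u = c_i/1`. -/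
local notation3 "KA" => Ideal.span {chartBase c i (c i)}
/-- The chart quotient `B_i/(u)` as a polynomial ring. -/
local notation3 "Pq" => MvPolynomial {j : Fin n // j ≠ i} (R ⧸ Ideal.span (Set.range c))
/-- The polynomial ring with `T_d` killed as well. -/
local notation3 "Tq" => MvPolynomial {j : {j : Fin n // j ≠ i} // j ∉ ({d} : Set {j : Fin n // j ≠ i})}
  (R ⧸ Ideal.span (Set.range c))

/-- `∂T_r/∂T_r = 1`: the Jacobian condition holds for a variable. [cite: Matsumura1987, Thm. 14.2] -/
theorem jacobian_X {k : Type u} [CommRing k] {τ : Type} (r : τ) :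
    ∀ Q : Ideal (MvPolynomial τ k), Q.IsPrime → (MvPolynomial.X r : MvPolynomial τ k) ∈ Q →
      ∃ j, MvPolynomial.pderiv j (MvPolynomial.X r : MvPolynomial τ k) ∉ Q := by
  classical
  intro Q hQ _
  refine ⟨r, ?_⟩
  rw [MvPolynomial.pderiv_X_self]
  exact fun h => hQ.ne_top (Q.eq_top_of_isUnit_mem h isUnit_one)

/-- **The host reduces to a variable ⇒ all hypotheses.** If `v ∈ B_i` is `F` modulo `u` and
`F|_{T_d = 0} = T_r`, then (`R/(c)` a regular domain): `(u, e_d, v)` is weakly regular, it is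
quasi-regular, and `B_i/(u, e_d, v)` is a regular ring.
[cite: Matsumura1987, Thm. 14.2] [cite: Matsumura1987, Thm. 16.2 (i)] [cite: StacksProject, Tag 0BIQ] -/
theorem hyps_of_kill_eq_X [IsDomain (R ⧸ Ideal.span (Set.range c))]
    [IsRegularRing (R ⧸ Ideal.span (Set.range c))] (hc : IsQuasiRegular c) (F : Pq) (v : chartRing c i)
    (hv : chartQuotEquiv c i hc F = Ideal.Quotient.mk KA v)
    (r : {j : {j : Fin n // j ≠ i} // j ∉ ({d} : Set {j : Fin n // j ≠ i})})
    (hG : MvPolynomial.quotientSpanXEquiv ({d} : Set {j : Fin n // j ≠ i}) (Ideal.Quotient.mk _ F) =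
      (MvPolynomial.X r : Tq)) :
    RingTheory.Sequence.IsWeaklyRegular (chartRing c i) [chartBase c i (c i), chartGen c i d.1, v] ∧
    IsQuasiRegular (![chartBase c i (c i), chartGen c i d.1, v] : Fin 3 → chartRing c i) ∧
    IsRegularRing (chartRing c i ⧸ (KA ⊔ Ideal.span {chartGen c i d.1} ⊔ Ideal.span {v})) :=
  ⟨isWeaklyRegular_u_gen_v c i d hc F v hv _ hG (MvPolynomial.X_ne_zero r),
    isQuasiRegular_u_gen_v c i d hc F v hv _ hG (MvPolynomial.X_ne_zero r),
    isRegularRing_quot_u_gen_v c i d hc F v hv _ hG (jacobian_X r)⟩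

omit d in
/-- **The host is regular modulo `u`** when `F ≠ 0` (`B_i/(u) ≅ (R/(c))[T]` is a domain).
[cite: StacksProject, Tag 0BIQ] -/
theorem forall_mem_span_of_ne_zero [IsDomain (R ⧸ Ideal.span (Set.range c))] (hc : IsQuasiRegular c)
    (F : Pq) (v : chartRing c i) (hv : chartQuotEquiv c i hc F = Ideal.Quotient.mk KA v) (hF0 : F ≠ 0) :
    ∀ g, v * g ∈ KA → g ∈ KA := by
  haveI : IsDomain (chartRing c i ⧸ KA) := isDomain_chartRing_quot_span c i hc
  have hv0 : Ideal.Quotient.mk KA v ≠ 0 := by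
    rw [← hv]
    exact fun h => hF0 ((map_eq_zero_iff _ (chartQuotEquiv c i hc).injective).mp h)
  intro g hg
  have h0 : Ideal.Quotient.mk KA v * Ideal.Quotient.mk KA g = 0 := by
    rw [← map_mul, Ideal.Quotient.eq_zero_iff_mem]
    exact hg
  rcases mul_eq_zero.mp h0 with h | h
  · exact absurd h hv0
  · exact Ideal.Quotient.eq_zero_iff_mem.mp h

omit d in
/-- **The host is a non-zero-divisor of the chart ring** when `F ≠ 0`, `R` is a domain and
`c_i ≠ 0`: the chart ring embeds into the domain `R[(c)/c_i] ⊆ R[1/c_i]`, and `v ∉ (u)`.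
[cite: StacksProject, Tag 0804] -/
theorem mem_nonZeroDivisors_host [IsDomain R] [IsDomain (R ⧸ Ideal.span (Set.range c))]
    (hc : IsQuasiRegular c) (hci : c i ≠ 0) (F : Pq) (v : chartRing c i)
    (hv : chartQuotEquiv c i hc F = Ideal.Quotient.mk KA v) (hF0 : F ≠ 0) :
    v ∈ (chartRing c i)⁰ := by
  -- through the affine model `R[(c)/c_i] ⊆ R[1/c_i]`, a domain
  have hle : Submonoid.powers (c i) ≤ R⁰ := powers_le_nonZeroDivisors_of_noZeroDivisors hci
  haveI : IsDomain (Localization.Away (c i)) := IsLocalization.isDomain_localization hle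
  haveI : IsDomain (blowupAlgebra (Ideal.span (Set.range c)) (c i)) := inferInstance
  have hτ := blowupAlgebra.toBlowupAlgebra_bijective c i
  refine mem_nonZeroDivisors_of_injective (f := blowupAlgebra.toBlowupAlgebra c i) hτ.1
    (mem_nonZeroDivisors_of_ne_zero fun hv0 => ?_)
  have hv0' : v = 0 := (map_eq_zero_iff _ hτ.1).mp hv0
  have h1 : chartQuotEquiv c i hc F = 0 := by rw [hv, hv0', map_zero]
  exact hF0 ((map_eq_zero_iff _ (chartQuotEquiv c i hc).injective).mp h1)

/-- **`(u, v, e_d)` is weakly regular** when `(u, e_d, v)` is and `F ≠ 0`: `v` is regular modulo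
`u` (`forall_mem_span_of_ne_zero`) and `e_d` is regular modulo `(u, v)` by the exchange lemma
of part 1. [cite: Matsumura1987, Thm. 16.2 (i)] -/
theorem isWeaklyRegular_u_host_gen [IsDomain (R ⧸ Ideal.span (Set.range c))] (hc : IsQuasiRegular c)
    (F : Pq) (v : chartRing c i) (hv : chartQuotEquiv c i hc F = Ideal.Quotient.mk KA v) (hF0 : F ≠ 0)
    (hw : RingTheory.Sequence.IsWeaklyRegular (chartRing c i) [chartBase c i (c i), chartGen c i d.1, v]) :
    RingTheory.Sequence.IsWeaklyRegular (chartRing c i) [chartBase c i (c i), v, chartGen c i d.1] :=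
  isWeaklyRegular_three (reesChartBase_mem_nonZeroDivisors (c i) (Ideal.mem_span_range_self (f := c) (x := i)))
    (forall_mem_span_of_ne_zero c i hc F v hv hF0)
    (forall_mem_sup_exchange (forall_mem_of_isWeaklyRegular₂ hw) (forall_mem_of_isWeaklyRegular₃ hw))

/-- `F ≠ 0` when it reduces to a variable after killing `T_d`. [folklore] -/
theorem ne_zero_of_kill_eq_X [Nontrivial (R ⧸ Ideal.span (Set.range c))] (F : Pq)
    (r : {j : {j : Fin n // j ≠ i} // j ∉ ({d} : Set {j : Fin n // j ≠ i})})
    (hG : MvPolynomial.quotientSpanXEquiv ({d} : Set {j : Fin n // j ≠ i}) (Ideal.Quotient.mk _ F) =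
      (MvPolynomial.X r : Tq)) : F ≠ 0 := by
  intro h
  rw [h, map_zero, map_zero] at hG
  exact MvPolynomial.X_ne_zero r hG.symm

end Kill

/-! ## The three shapes of the host -/

section Shapes

variable {R : Type u} [CommRing R] {n : ℕ} (c : Fin n → R) (i : Fin n) (m k r : {j : Fin n // j ≠ i})

/-- The killed variable vanishes in the quotient. [folklore] -/
theorem mk_X_killed (d : {j : Fin n // j ≠ i}) :
    Ideal.Quotient.mk (Ideal.span (MvPolynomial.X '' ({d} : Set {j : Fin n // j ≠ i}) :
      Set (MvPolynomial {j : Fin n // j ≠ i} (R ⧸ Ideal.span (Set.range c)))))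
      (MvPolynomial.X d) = 0 :=
  Ideal.Quotient.eq_zero_iff_mem.mpr (Ideal.subset_span (Set.mem_image_of_mem _ (Set.mem_singleton d)))

/-- The host `e_m e_k + e_r` modulo `u` is `T_m T_k + T_r`. [cite: StacksProject, Tag 0BIQ] -/
theorem host_mul_mod (hc : IsQuasiRegular c) :
    chartQuotEquiv c i hc (MvPolynomial.X m * MvPolynomial.X k + MvPolynomial.X r) =
      Ideal.Quotient.mk (Ideal.span {chartBase c i (c i)})
        (chartGen c i m.1 * chartGen c i k.1 + chartGen c i r.1) := by
  rw [map_add (Ideal.Quotient.mk _) (chartGen c i m.1 * chartGen c i k.1) (chartGen c i r.1),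
    map_mul (Ideal.Quotient.mk _) (chartGen c i m.1) (chartGen c i k.1), map_add, map_mul,
    chartQuotEquiv_apply, chartQuotEquiv_apply, chartQuotEquiv_apply, chartQuotMap_X, chartQuotMap_X,
    chartQuotMap_X]

/-- **Chart of `x₂`, killing the first factor** (`v = e_m e_k + e_r`, `d = m`): `(u, v, e_m)` is
weakly regular, `B_i/(u, e_m, v)` is regular and `v` is a non-zero-divisor (`R` a domain, `R/(c)` a
regular domain, `c` quasi-regular with `c_i ≠ 0`, `m, k, r` distinct).
[cite: Matsumura1987, Thm. 14.2] [cite: StacksProject, Tag 0BIQ] -/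
theorem hyps_host_mul_left [IsDomain R] [IsDomain (R ⧸ Ideal.span (Set.range c))]
    [IsRegularRing (R ⧸ Ideal.span (Set.range c))] (hc : IsQuasiRegular c) (hci : c i ≠ 0)
    (hmk : m ≠ k) (hmr : m ≠ r) :
    RingTheory.Sequence.IsWeaklyRegular (chartRing c i)
      [chartBase c i (c i), chartGen c i m.1 * chartGen c i k.1 + chartGen c i r.1, chartGen c i m.1] ∧
    IsRegularRing (chartRing c i ⧸ (Ideal.span {chartBase c i (c i)} ⊔ Ideal.span {chartGen c i m.1} ⊔
      Ideal.span {chartGen c i m.1 * chartGen c i k.1 + chartGen c i r.1})) ∧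
    chartGen c i m.1 * chartGen c i k.1 + chartGen c i r.1 ∈ (chartRing c i)⁰ := by
  classical
  have hkm : k ∉ ({m} : Set {j : Fin n // j ≠ i}) := by rw [Set.mem_singleton_iff]; exact fun h => hmk h.symm
  have hrm : r ∉ ({m} : Set {j : Fin n // j ≠ i}) := by rw [Set.mem_singleton_iff]; exact fun h => hmr h.symm
  have hv := host_mul_mod c i m k r hc
  have hG : MvPolynomial.quotientSpanXEquiv ({m} : Set {j : Fin n // j ≠ i})
      (Ideal.Quotient.mk _ (MvPolynomial.X m * MvPolynomial.X k + MvPolynomial.X r :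
        MvPolynomial {j : Fin n // j ≠ i} (R ⧸ Ideal.span (Set.range c)))) =
      MvPolynomial.X ⟨r, hrm⟩ := by
    rw [map_add (Ideal.Quotient.mk _), map_mul (Ideal.Quotient.mk _), mk_X_killed, zero_mul, zero_add,
      MvPolynomial.quotientSpanXEquiv_mk_X]
  have hF0 := ne_zero_of_kill_eq_X c i m _ ⟨r, hrm⟩ hG
  obtain ⟨hw, -, hreg⟩ := hyps_of_kill_eq_X c i m hc _ _ hv ⟨r, hrm⟩ hG
  exact ⟨isWeaklyRegular_u_host_gen c i m hc _ _ hv hF0 hw, hreg, mem_nonZeroDivisors_host c i hc hci _ _ hv hF0⟩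

/-- **Chart of `x₂`, killing the second factor** (`v = e_m e_k + e_r`, `d = k`): `(u, v, e_k)` is
weakly regular and `B_i/(u, e_k, v)` is regular. [cite: Matsumura1987, Thm. 14.2] [cite: StacksProject, Tag 0BIQ] -/
theorem hyps_host_mul_right [IsDomain (R ⧸ Ideal.span (Set.range c))]
    [IsRegularRing (R ⧸ Ideal.span (Set.range c))] (hc : IsQuasiRegular c)
    (hmk : m ≠ k) (hkr : k ≠ r) :
    RingTheory.Sequence.IsWeaklyRegular (chartRing c i)
      [chartBase c i (c i), chartGen c i m.1 * chartGen c i k.1 + chartGen c i r.1, chartGen c i k.1] ∧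
    IsRegularRing (chartRing c i ⧸ (Ideal.span {chartBase c i (c i)} ⊔ Ideal.span {chartGen c i k.1} ⊔
      Ideal.span {chartGen c i m.1 * chartGen c i k.1 + chartGen c i r.1})) := by
  classical
  have hmk' : m ∉ ({k} : Set {j : Fin n // j ≠ i}) := by rw [Set.mem_singleton_iff]; exact hmk
  have hrk : r ∉ ({k} : Set {j : Fin n // j ≠ i}) := by rw [Set.mem_singleton_iff]; exact fun h => hkr h.symm
  have hv := host_mul_mod c i m k r hc
  have hG : MvPolynomial.quotientSpanXEquiv ({k} : Set {j : Fin n // j ≠ i})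
      (Ideal.Quotient.mk _ (MvPolynomial.X m * MvPolynomial.X k + MvPolynomial.X r :
        MvPolynomial {j : Fin n // j ≠ i} (R ⧸ Ideal.span (Set.range c)))) =
      MvPolynomial.X ⟨r, hrk⟩ := by
    rw [map_add (Ideal.Quotient.mk _), map_mul (Ideal.Quotient.mk _), mk_X_killed, mul_zero, zero_add,
      MvPolynomial.quotientSpanXEquiv_mk_X]
  have hF0 := ne_zero_of_kill_eq_X c i k _ ⟨r, hrk⟩ hG
  obtain ⟨hw, -, hreg⟩ := hyps_of_kill_eq_X c i k hc _ _ hv ⟨r, hrk⟩ hG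
  exact ⟨isWeaklyRegular_u_host_gen c i k hc _ _ hv hF0 hw, hreg⟩

/-- **Charts of `x₀`, `x₁`** (`v = e_m + e_k e_r`, kill `e_r`): `(u, e_r, v)` is quasi-regular and
`B_i/(u, e_r, v)` is regular — the inputs of the conic tower with centre `(u, e_r, v)`.
[cite: Matsumura1987, Thm. 14.2] [cite: StacksProject, Tag 0BIQ] -/
theorem hyps_host_add [IsDomain (R ⧸ Ideal.span (Set.range c))]
    [IsRegularRing (R ⧸ Ideal.span (Set.range c))] (hc : IsQuasiRegular c)
    (hmr : m ≠ r) (hkr : k ≠ r) :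
    IsQuasiRegular (![chartBase c i (c i), chartGen c i r.1,
      chartGen c i m.1 + chartGen c i k.1 * chartGen c i r.1] : Fin 3 → chartRing c i) ∧
    IsRegularRing (chartRing c i ⧸ (Ideal.span {chartBase c i (c i)} ⊔ Ideal.span {chartGen c i r.1} ⊔
      Ideal.span {chartGen c i m.1 + chartGen c i k.1 * chartGen c i r.1})) := by
  classical
  have hmr' : m ∉ ({r} : Set {j : Fin n // j ≠ i}) := by rw [Set.mem_singleton_iff]; exact hmr
  have hkr' : k ∉ ({r} : Set {j : Fin n // j ≠ i}) := by rw [Set.mem_singleton_iff]; exact hkr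
  have hv : chartQuotEquiv c i hc (MvPolynomial.X m + MvPolynomial.X k * MvPolynomial.X r) =
      Ideal.Quotient.mk (Ideal.span {chartBase c i (c i)})
        (chartGen c i m.1 + chartGen c i k.1 * chartGen c i r.1) := by
    rw [map_add (Ideal.Quotient.mk _) (chartGen c i m.1) (chartGen c i k.1 * chartGen c i r.1),
      map_mul (Ideal.Quotient.mk _) (chartGen c i k.1) (chartGen c i r.1), map_add, map_mul,
      chartQuotEquiv_apply, chartQuotEquiv_apply, chartQuotEquiv_apply, chartQuotMap_X, chartQuotMap_X,
      chartQuotMap_X]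
  have hG : MvPolynomial.quotientSpanXEquiv ({r} : Set {j : Fin n // j ≠ i})
      (Ideal.Quotient.mk _ (MvPolynomial.X m + MvPolynomial.X k * MvPolynomial.X r :
        MvPolynomial {j : Fin n // j ≠ i} (R ⧸ Ideal.span (Set.range c)))) =
      MvPolynomial.X ⟨m, hmr'⟩ := by
    rw [map_add (Ideal.Quotient.mk _), map_mul (Ideal.Quotient.mk _), mk_X_killed, mul_zero, add_zero,
      MvPolynomial.quotientSpanXEquiv_mk_X]
  obtain ⟨-, hq, hreg⟩ := hyps_of_kill_eq_X c i r hc _ _ hv ⟨m, hmr'⟩ hG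
  exact ⟨hq, hreg⟩

end Shapes

end CrossingLines

end Summit.ResolutionOfSingularities.ResolutionOfSingularities.Theorems

end
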